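import Summits.CriticalPhenomena.SAWScalingLimit.Theses.SAWDevelopingMap
import Summits.CriticalPhenomena.SAWScalingLimit.Theses.SAWResidueField
import Summits.CriticalPhenomena.SAWScalingLimit.Cruxes.HexTight.Disproof
import Summits.CriticalPhenomena.SAWScalingLimit.Theorems.HexTight.Negative.NotRenewalGluing


/-!
# drefute probes for line `reversal-virgin-disc` of crux `HexTight` (stmt-CriticalPhenomena-5423)

Refuter `refuter-drefute-stmt-CriticalPhenomena-5423-0`, 2026-08-16. Published as
`Cruxes/HexTight/DrefutePerShellTight.lean` (evidence for the lead; NOT a Theorems file).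

Part 1 (ll. below the namespace line up to `bulkOneArmDecay_of`) is a VERBATIM copy of the objects
and statements of `Cruxes/HexTight/Lines/reversal-virgin-disc.lean` (generation 2), placed in the
separate namespace `…Cruxes.HexTight.DrefuteRVD` so that nothing clashes with the skeleton (crux
work files cannot be imported; the Lines module is not built on the farm).

Part 2 (`section PerShell`) is new and sorry-free (axioms `propext`, `Classical.choice`, `Quot.sound`):

* `shellBound_of_perShellTight`, `interiorShellBound_of_perShellTight`,
  `boundaryShellBound_of_perShellTight`, `hexTraversalBound_of_perShellTight` — because the
  threshold `k x ρ R` of `InteriorShellBound` / `BoundaryShellBound` / `Disproof.HexTraversalBound`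
  is FREE PER SHELL, the power law `K (ρ/R)^lam` is, shell by shell, just a positive number: per-shell
  TIGHTNESS of the traversal count (uniform in `δ ∈ (0, δ₀]`) already gives the bound with `K = 1`,
  `lam = 3`. (The HexConjecture disprover records the same remark informally,
  `Cruxes/HexConjecture/Disproof.lean` l. 97.)
* `exists_not_hasTraversals_of_isCompact` — a compact set of curve classes traverses a genuine
  shell boundedly often (finite subcover + `Curve.exists_not_hasTraversals` + an `ε` of room,
  `hasTraversals_of_dist_lt`, `hasTraversals_reparam_iff`).
* `hexTraversalBound_of_crux : Crux → ∀ D a b, IsEmbEndpointApprox … → HexTraversalBound D a b` —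
  with `Disproof.crux_of_traversalBound` the AB rung of §6 is an EQUIVALENCE; hence
  `boundaryShells_of_crux : Crux → BoundaryShells`, `interiorShellBound_of_crux`,
  `virginization_of_crux : Crux → Virginization` (stubs 5 and 6 assert pieces of the crux itself:
  they cannot be false unless the crux is).
* `ArcTraversalTight`, `RootedTraversalTight` — the rate-free signatures that suffice for the
  consumer `Virginization` in place of `ArcShellBound` (`∀ lam ∃ k₀ K …`, `λ(k₀) → ∞`) and
  `RootedShellBound`; the rooted one also carries `hexGraph.Adj q p` (see the two `example`s: the
  complete graph `⊤` is a virgin `H`, for which `H.Adj q p` only says `q ≠ p`; the disprover's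
  `Disproof.lean` gen 3 §7b records the same typing remark independently).
-/

noncomputable section

open scoped BigOperators Classical ENNReal NNReal
open MeasureTheory Filter Topology Set Metric
open Literature.Probability.LatticeModels Literature.Probability.RandomPlanarGeometry
  Literature.Probability.RandomPlanarGeometry.SAW
open Summit.CriticalPhenomena.SAWScalingLimit.Cruxes.HexTight.Disproof
  (sawCurve mk_sawCurve HexTraversalBound crux_of_traversalBound)

namespace Summit.CriticalPhenomena.SAWScalingLimit.Cruxes.HexTight.DrefuteRVD

/-! ## Objects: `x_c`-weighted self-avoiding arcs between mid-edges, using only `H`-edges -/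

variable {Λ : Finset HexVertex} {w w' : Sym2 HexVertex}

/-- The arc `γ` uses only edges of the graph `H` (in applications `H = hexDomainGraph Ω δ`,
the discrete domain graph carrying `hexSAWLaw`; inside a virgin disc `H` is all of `hexGraph`). -/
def IsHArc (H : SimpleGraph HexVertex) (γ : HexMidEdgeSAW Λ w w') : Prop :=
  γ.verts.IsChain H.Adj

/-- The arc as a parametrised polyline `mid(w), c(v₁), …, c(vₙ), mid(w')` (lattice units). -/
def arcCurve (γ : HexMidEdgeSAW Λ w w') : Curve ℂ := ⟨polyline γ.points⟩

/-- `Z^H_Λ(w → w')`: the `x_c`-mass of the `H`-arcs of `Λ` from `w` to `w'`. -/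
def arcMass (H : SimpleGraph HexVertex) (Λ : Finset HexVertex) (w w' : Sym2 HexVertex) : ℝ :=
  ∑ γ : HexMidEdgeSAW Λ w w', if IsHArc H γ then hexCriticalFugacity ^ γ.length else 0

/-- The `x_c`-mass of the `H`-arcs `w → w'` of `Λ` that DIVE to radius `r` about `z₀`: some
visited vertex has its centre in the closed disc `B̄(z₀, r)`. -/
def diveMass (H : SimpleGraph HexVertex) (Λ : Finset HexVertex) (w w' : Sym2 HexVertex)
    (z₀ : ℂ) (r : ℝ) : ℝ :=
  ∑ γ : HexMidEdgeSAW Λ w w',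
    if IsHArc H γ ∧ ∃ v ∈ γ.verts, dist (hexCenter v) z₀ ≤ r then
      hexCriticalFugacity ^ γ.length else 0

/-- The `x_c`-mass of the `H`-arcs `w → w'` of `Λ` whose polyline traverses the shell
`D(z₀; r, R)` by `k` separate segments (`Curve.HasTraversals`, the AB99 event). -/
def travMass (H : SimpleGraph HexVertex) (Λ : Finset HexVertex) (w w' : Sym2 HexVertex)
    (k : ℕ) (z₀ : ℂ) (r R : ℝ) : ℝ :=
  ∑ γ : HexMidEdgeSAW Λ w w',
    if IsHArc H γ ∧ (arcCurve γ).HasTraversals k z₀ r R then hexCriticalFugacity ^ γ.length else 0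

/-- **`w` is a DOOR of `Λ` on the circle of radius `N` about `z₀`**: `w = {u, c}` is an edge of
`ℍ` with `c ∈ Λ` in the closed disc and `u ∉ Λ` strictly outside it. (In applications `u` is
the last vertex of a frozen outside piece and `c` the first vertex of the live arc; triage r1-3's
door binder, strengthened.) -/
def Straddles (Λ : Finset HexVertex) (z₀ : ℂ) (N : ℝ) (w : Sym2 HexVertex) : Prop :=
  ∃ u c : HexVertex, w = s(u, c) ∧ hexGraph.Adj u c ∧ u ∉ Λ ∧ c ∈ Λ ∧
    dist (hexCenter c) z₀ ≤ N ∧ N < dist (hexCenter u) z₀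

/-- **VIRGIN DISC**: the open lattice disc of radius `N` about `z₀` lies in `Λ`, and `H`
contains every edge of `ℍ` between cells of the closed `(N+1)`-disc (one lattice unit of
collar: edge length is `1/√3`). Nothing is assumed outside. -/
structure IsVirgin (H : SimpleGraph HexVertex) (Λ : Finset HexVertex) (z₀ : ℂ) (N : ℝ) :
    Prop where
  mem : ∀ v : HexVertex, dist (hexCenter v) z₀ < N → v ∈ Λ
  adj : ∀ v v' : HexVertex, dist (hexCenter v) z₀ ≤ N + 1 → dist (hexCenter v') z₀ ≤ N + 1 →
    hexGraph.Adj v v' → H.Adj v v'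

/-! ## Statements of the line

The six REGISTERED stub statements are the named Props `DiveRecursion`, `OneScaleDive`, `VisitCharge`,
`RootedShellBound`, `Virginization`, `BoundaryShells` (one `theorem stub_… : <Name> := by sorry` each);
`BulkOneArmDecay` (proved milestone), `ArcShellBound`, `InteriorShellBound`, `BoundaryShellBound` are
auxiliary. (Obligation-tag attributes are gate-reserved, so none is written in this seat file.) -/

/-- **REVERSAL RECURSION** (first lemma of the card; exact, provable now). In a virgin
configuration at radius `N` with doors `w, w'`, for radii `r₂ ≤ r₁ ≤ N`: if every virgin
sub-configuration `(H, Λ' ⊆ Λ)` at radius `r₁` with doors `u, u'` has dive-to-`r₂` ratio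
`≤ q`, then `diveMass(r₂) ≤ q · diveMass(r₁)`. Proof: cut an arc diving to `r₂` at its FIRST
vertex `c₁` in `B̄(z₀, r₁)` (prefix `β`, door `m = {last β, c₁}` — or `m = w` if `β = []`), cut
it again at its LAST vertex `c_L` there (suffix `β'`, door `m' = {c_L, first β'}`); the connector
is an `H`-arc `m → m'` of `Λ' = Λ ∖ β ∖ β'`, which is virgin at `r₁` (`β, β'` lie outside
`B̄(z₀,r₁)`; `IsVirgin.adj` is inherited since `r₁ + 1 ≤ N + 1`), and for a fixed GROUP INDEX
`(β, m, m', β')` the map arc ↦ connector is a length-additive bijection onto ALL `H`-arcs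
`m → m'` of `Λ'` (they glue back: vertex classes disjoint, `m ≠ m'`, junction edges are the
group's own); an arc dives to `r₂` iff its connector does, and every arc of the group dives to
`r₁`. Sum the hypothesis over the groups. -/
def DiveRecursion : Prop :=
  ∀ (H : SimpleGraph HexVertex) (Λ : Finset HexVertex) (z₀ : ℂ) (N r₁ r₂ q : ℝ)
    (w w' : Sym2 HexVertex),
    0 ≤ q → r₂ ≤ r₁ → r₁ ≤ N →
    IsVirgin H Λ z₀ N → Straddles Λ z₀ N w → Straddles Λ z₀ N w' →
    (∀ (Λ' : Finset HexVertex) (u u' : Sym2 HexVertex), Λ' ⊆ Λ →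
        IsVirgin H Λ' z₀ r₁ → Straddles Λ' z₀ r₁ u → Straddles Λ' z₀ r₁ u' →
        diveMass H Λ' u u' z₀ r₂ ≤ q * arcMass H Λ' u u') →
    diveMass H Λ w w' z₀ r₂ ≤ q * diveMass H Λ w w' z₀ r₁

/-- **ONE-SCALE DIVE BOUND `q* < 1`** (atom 1 of the card). Uniformly over virgin
configurations at radius `N ≥ N₀` (arbitrary exterior `Λ, H`; arbitrary doors `w, w'` on the
circle), the arcs that dive to radius `N/2` carry at most the fraction `q < 1` of the arc mass.
Rate-free, one aspect ratio. (Continuum heuristic: `sup` over exteriors of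
`P[SLE₈/₃-type chord between two points of ∂B(0,1) meets B̄(0,1/2)] < 1`; the NON-diving route is
the virgin rim corridor of width `N/2`, which nothing outside can block or thin; false off
criticality — any proof must use `x = x_c`.) -/
def OneScaleDive : Prop :=
  ∃ q : ℝ, 0 ≤ q ∧ q < 1 ∧ ∃ N₀ : ℝ, ∀ (H : SimpleGraph HexVertex) (Λ : Finset HexVertex)
    (z₀ : ℂ) (N : ℝ) (w w' : Sym2 HexVertex), N₀ ≤ N →
    IsVirgin H Λ z₀ N → Straddles Λ z₀ N w → Straddles Λ z₀ N w' →
    diveMass H Λ w w' z₀ (N / 2) ≤ q * arcMass H Λ w w'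

/-- **BULK ONE-ARM DECAY** (milestone M1; PROVED below from `DiveRecursion` + `OneScaleDive`:
`bulkOneArmDecay_of`, the recursion iterated over the dyadic radii `2^j N` with the one-scale
bound at each level): arcs of a configuration virgin at radius `2^m N` that dive through `m`
dyadic shells to radius `N` carry at most `q^m` of the mass. -/
def BulkOneArmDecay : Prop :=
  ∃ q : ℝ, 0 ≤ q ∧ q < 1 ∧ ∃ N₀ : ℝ, ∀ (m : ℕ) (H : SimpleGraph HexVertex)
    (Λ : Finset HexVertex) (z₀ : ℂ) (N : ℝ) (w w' : Sym2 HexVertex), N₀ ≤ N →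
    IsVirgin H Λ z₀ (2 ^ m * N) → Straddles Λ z₀ (2 ^ m * N) w →
    Straddles Λ z₀ (2 ^ m * N) w' →
    diveMass H Λ w w' z₀ N ≤ q ^ m * arcMass H Λ w w'

/-- **CHORDAL ARC SHELL BOUND** (AB99 (H1) for rim-to-rim arcs of a virgin disc, with
`λ(k₀) → ∞`): for every target exponent `lam` there are a threshold `k₀` and constants such
that, uniformly over virgin configurations at radius `N` with doors `w, w'` and over
`N₀ ≤ n ≤ N/4`, the arcs whose polyline traverses `D(z₀; n, N/2)` by `k₀` separate segments
carry at most `K (n/N)^lam` of the arc mass. (Only `lam > 6` is consumed downstream — the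
cube-root trick of `Virginization` divides exponents by `3` — but the multiplicative mechanism
that gives one exponent gives them all; heuristic `λ(2j) = x_{2j} = (36j²-4)/48`.) -/
def ArcShellBound : Prop :=
  ∀ lam : ℝ, 0 < lam → ∃ (k₀ : ℕ) (K N₀ : ℝ), 0 ≤ K ∧ 0 < N₀ ∧
    ∀ (H : SimpleGraph HexVertex) (Λ : Finset HexVertex) (z₀ : ℂ) (n N : ℝ)
      (w w' : Sym2 HexVertex), N₀ ≤ n → 4 * n ≤ N →
      IsVirgin H Λ z₀ N → Straddles Λ z₀ N w → Straddles Λ z₀ N w' →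
      travMass H Λ w w' k₀ z₀ n (N / 2) ≤ K * (n / N) ^ lam * arcMass H Λ w w'

/-- **VISIT CHARGE** (atom 2, the hard one): the recursion and the one-scale first-dive bound
upgrade to the `k₀`-fold chordal shell bound. The registered stub is this implication, so its
prover may use `DiveRecursion`, `OneScaleDive` and the proved milestone `bulkOneArmDecay_of`
(first dive priced: `q^{log₂(N/n)} = (n/N)^{θ₁}`). The residue is the charge on FURTHER deep
dives of an arc in "virgin disc minus its own earlier boundary-attached dives". WARNING recorded
for the prover (gen 2): a naive spiked one-scale bound "∃ an avoiding path ⇒ dive ratio ≤ θ < 1"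
is FALSE in spiked discs (two spikes leaving only a one-cell gap make the wide route the diving
one; thin gaps carry exponentially small `x_c`-mass) — the charge must be KS-shaped: unforced
re-entries into components of the shell cut out by the arc's own past (Kemppainen–Smirnov,
arXiv:1212.6215, Def. 2.3 with `A^u_τ`, index Lemma 3.6), forced ones paid at the creation of
the straddling configuration. -/
def VisitCharge : Prop :=
  DiveRecursion → OneScaleDive → ArcShellBound

/-- **RADIAL (ROOTED) ARC SHELL BOUND** — the deep-endpoint case of the cube-root trick: arcs
of a virgin configuration at radius `N` from a door `w` on the circle to a ROOT VERTEX `p` with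
`dist(c(p), z₀) ≤ n` (in applications `p = a_δ` or `b_δ`), encoded as `H`-arcs of `Λ ∖ {p}`
from `w` to the mid-edge `{q, p}` through which they step into `p` (`q` any neighbour with
`H.Adj q p`). The first inward traversal is free; `k₀` separate traversals of `D(z₀; n, N/2)`
cost `K (n/N)^lam`, `lam` as large as desired (heuristic `x_{2j+1} - x_1 → ∞`; only `lam > 6`
is consumed). NOTE: the tempting alternative "rim-to-rim arcs in a disc carrying one FROZEN
spike" is false as a `sup` (a meander-shaped spike forces arbitrarily many oscillations), which
is why the initial segment is kept random inside this rooted class. -/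
def RootedShellBound : Prop :=
  ∀ lam : ℝ, 0 < lam → ∃ (k₀ : ℕ) (K N₀ : ℝ), 0 ≤ K ∧ 0 < N₀ ∧
    ∀ (H : SimpleGraph HexVertex) (Λ : Finset HexVertex) (z₀ : ℂ) (n N : ℝ)
      (w : Sym2 HexVertex) (p q : HexVertex), N₀ ≤ n → 4 * n ≤ N →
      IsVirgin H Λ z₀ N → Straddles Λ z₀ N w → dist (hexCenter p) z₀ ≤ n → H.Adj q p →
      travMass H (Λ.erase p) w s(q, p) k₀ z₀ n (N / 2) ≤
        K * (n / N) ^ lam * arcMass H (Λ.erase p) w s(q, p)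

/-- **(H1) on INTERIOR shells** of the Dobrushin domain (`closedBall x R ⊆ Ω`) for the
critical hexagonal SAW law: the output of virginization. Shell-dependent threshold (as in
`Disproof.HexTraversalBound`), eventually in the mesh. -/
def InteriorShellBound (D : DobrushinDomain) (a b : ℝ → HexVertex) : Prop :=
  ∃ (k : ℂ → ℝ → ℝ → ℕ) (K lam δ₀ : ℝ), 0 ≤ K ∧ 2 < lam ∧ 0 < δ₀ ∧
    ∀ δ ∈ Set.Ioc 0 δ₀, ∀ (x : ℂ) (ρ R : ℝ), δ ≤ ρ → ρ < R → R ≤ 1 →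
      closedBall x R ⊆ D.carrier →
      hexSAWLaw D.carrier δ (a δ) (b δ)
        {γ | (sawCurve γ).HasTraversals (k x ρ R) x ρ R} ≤ ENNReal.ofReal (K * (ρ / R) ^ lam)

/-- **(H1) on BOUNDARY shells** (`closedBall x R ⊄ Ω`: the ball meets `∂Ω` or leaves the
domain): the regime this line does NOT reduce — after virginization the ball still contains
the frozen boundary pattern `Ω_δ ∩ B̄(x,R)`. The shell-dependent threshold `k x ρ R` absorbs the
crossings forced by the excursions of the Jordan curve `∂Ω` across the shell (finitely many
per shell, `δ`-independent — the percolation template's bookkeeping,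
`Percolation.bondExploration_traversalBound`); the content is that unforced excursions into
boundary bays are polynomially rare (boundary repulsion of the critical SAW). -/
def BoundaryShellBound (D : DobrushinDomain) (a b : ℝ → HexVertex) : Prop :=
  ∃ (k : ℂ → ℝ → ℝ → ℕ) (K lam δ₀ : ℝ), 0 ≤ K ∧ 2 < lam ∧ 0 < δ₀ ∧
    ∀ δ ∈ Set.Ioc 0 δ₀, ∀ (x : ℂ) (ρ R : ℝ), δ ≤ ρ → ρ < R → R ≤ 1 →
      ¬ closedBall x R ⊆ D.carrier →
      hexSAWLaw D.carrier δ (a δ) (b δ)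
        {γ | (sawCurve γ).HasTraversals (k x ρ R) x ρ R} ≤ ENNReal.ofReal (K * (ρ / R) ^ lam)

/-- **VIRGINIZATION** (exact identities + bookkeeping; provable now): chordal and radial arc
shell bounds ⇒ (H1) on interior shells for every Dobrushin domain and endpoint approximation.
Ingredients: (i) two-sided domain Markov identity for `hexSAWLaw` (= `embLaw`, a normalised
finite sum of `x_c^{#vertices}` Diracs): conditioned on the pieces before the first vertex in /
after the last vertex in `closedBall x t` (`t ≤ R - 2δ`), the middle piece ranges over ALL
`H`-arcs of `Λ' = Ω_δ ∖ (outer pieces)`, `H = hexDomainGraph Ω δ`, between the two doors, and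
`(H, Λ')` is virgin at lattice radius `N = t/δ` about `x/δ` (cells of the closed `(t+δ)`-ball are
mesh vertices joined THROUGH the ball, hence ALL in the largest component or NONE — in the
latter case the event is empty); (ii) polyline time bookkeeping: every traversal of a sub-shell
of `D(x; ρ, t/2)` by `sawCurve γ` happens inside the middle piece, so it is a traversal of
`D(x/δ; ·/δ, ·/δ)` by `arcCurve` (scaling + restriction of `HasTraversals`); (iii) cube-root
trick for the marked lattice points `A = δc(a_δ)`, `B = δc(b_δ)`: of the three sub-shells of
`D(x;ρ,R)` of equal log-aspect one contains neither `A` nor `B`; on it either both endpoints are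
outside (chordal class, exponent `lam/3`), or one is deep inside (rooted class after reversing
the walk if needed — reversal symmetry of `hexSAWLaw` and `hasTraversals_reverse_iff`), or both
are deep, which puts them within `2ρ^{1/3}R^{2/3}` of each other and, by the endpoint limits
(`a ≠ b`, eventually `|A - B| ≥ |a - b|/2`), forces `ρ ≥ (|a-b|/4)³` so the bound is trivial;
with `lam = 7` the final exponent is `7/3 > 2`; (iv) small shells (`ρ^{2/3}R^{1/3} < N₀ δ`): the
event is EMPTY once the threshold exceeds twice the number of faces in a ball of `N₀ + 1`
lattice units (a SAW visits each face once; cf. `Disproof.not_hasTraversals_sawCurve`); thin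
shells (`R < 64ρ`) and `t` near `R` are absorbed into `K`. -/
def Virginization : Prop :=
  ArcShellBound → RootedShellBound →
    ∀ (D : DobrushinDomain) (a b : ℝ → HexVertex),
      IsEmbEndpointApprox hexGraph hexCenter D a b → InteriorShellBound D a b

/-- **BOUNDARY SHELLS** (open; NOT reduced by this line): (H1) on the shells meeting `∂Ω`, for
every Dobrushin domain and endpoint approximation, eventually in the mesh, with a shell-dependent
threshold absorbing the crossings forced by `∂Ω`. -/
def BoundaryShells : Prop :=
  ∀ (D : DobrushinDomain) (a b : ℝ → HexVertex),
    IsEmbEndpointApprox hexGraph hexCenter D a b → BoundaryShellBound D a b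

/-! ## Proved now: milestone M1 (`DiveRecursion → OneScaleDive → BulkOneArmDecay`) -/

/-- Dive mass is at most arc mass (termwise). -/
theorem diveMass_le_arcMass (H : SimpleGraph HexVertex) (Λ : Finset HexVertex)
    (w w' : Sym2 HexVertex) (z₀ : ℂ) (r : ℝ) :
    diveMass H Λ w w' z₀ r ≤ arcMass H Λ w w' := by
  unfold diveMass arcMass
  refine Finset.sum_le_sum fun γ _ => ?_
  have hx : 0 ≤ hexCriticalFugacity ^ γ.length := pow_nonneg hexCriticalFugacity_pos_lt_one.1.le _
  by_cases hA : IsHArc H γ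
  · by_cases hB : ∃ v ∈ γ.verts, dist (hexCenter v) z₀ ≤ r
    · rw [if_pos ⟨hA, hB⟩, if_pos hA]
    · rw [if_neg (fun h => hB h.2), if_pos hA]; exact hx
  · rw [if_neg (fun h => hA h.1), if_neg hA]

/-- **Milestone M1, proved**: the reversal recursion iterated over the dyadic radii `2^j N`, with
the one-scale bound at each level, gives power-law one-arm decay in every virgin disc
(`diveMass(N) ≤ q^m · arcMass` for configurations virgin at radius `2^m N`). This is the
card's "rate-free `q* < 1` ⇒ decay" mechanism, kernel-checked modulo the two inputs. -/
theorem bulkOneArmDecay_of (h₁ : DiveRecursion) (h₂ : OneScaleDive) : BulkOneArmDecay := by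
  obtain ⟨q, hq0, hq1, N₀, h⟩ := h₂
  refine ⟨q, hq0, hq1, max N₀ 1, ?_⟩
  intro m
  induction m with
  | zero =>
    intro H Λ z₀ N w w' hN hV hw hw'
    simpa using diveMass_le_arcMass H Λ w w' z₀ N
  | succ m ih =>
    intro H Λ z₀ N w w' hN hV hw hw'
    have hN0 : 0 ≤ N := le_trans (le_trans zero_le_one (le_max_right _ _)) hN
    have hN₀ : N₀ ≤ N := (le_max_left _ _).trans hN
    have h2m : (0 : ℝ) ≤ 2 ^ m := pow_nonneg (by norm_num) m
    have h2m1 : (1 : ℝ) ≤ 2 ^ m := one_le_pow₀ (by norm_num)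
    have hr21 : N ≤ 2 ^ m * N := by nlinarith
    have hr1N : 2 ^ m * N ≤ 2 ^ (m + 1) * N := by rw [pow_succ]; nlinarith
    -- the recursion from radius `2^(m+1) N`: `r₁ = 2^m N`, `r₂ = N`, ratio bound `q^m` (IH)
    have hrec := h₁ H Λ z₀ (2 ^ (m + 1) * N) (2 ^ m * N) N (q ^ m) w w' (pow_nonneg hq0 m)
      hr21 hr1N hV hw hw' (fun Λ' u u' _ hV' hu hu' => ih H Λ' z₀ N u u' hN hV' hu hu')
    -- the one-scale bound at radius `2^(m+1) N`
    have hone := h H Λ z₀ (2 ^ (m + 1) * N) w w' (hN₀.trans (hr21.trans hr1N)) hV hw hw'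
    have hhalf : 2 ^ (m + 1) * N / 2 = 2 ^ m * N := by rw [pow_succ]; ring
    rw [hhalf] at hone
    calc diveMass H Λ w w' z₀ N ≤ q ^ m * diveMass H Λ w w' z₀ (2 ^ m * N) := hrec
      _ ≤ q ^ m * (q * arcMass H Λ w w') := mul_le_mul_of_nonneg_left hone (pow_nonneg hq0 m)
      _ = q ^ (m + 1) * arcMass H Λ w w' := by rw [pow_succ]; ring



/-! ## Refuter probes (drefute): per-shell thresholds make (H1) rate-free -/

section PerShell

open Summit.CriticalPhenomena.SAWScalingLimit.Cruxes.HexTight.Disproof (Crux hexEventualTight_iff_crux)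

/-- Per-shell TIGHTNESS of the traversal count, uniformly in the mesh `δ ∈ (0, δ₀]`, on the shells
selected by `good` (interior: `closedBall x R ⊆ Ω`; boundary: its negation; all: `True`). -/
def PerShellTight (D : DobrushinDomain) (a b : ℝ → HexVertex) (good : ℂ → ℝ → Prop) : Prop :=
  ∃ δ₀ : ℝ, 0 < δ₀ ∧ ∀ (x : ℂ) (ρ R : ℝ), 0 < ρ → ρ < R → R ≤ 1 → good x R →
    ∀ η : ℝ, 0 < η → ∃ k : ℕ, ∀ δ ∈ Set.Ioc 0 δ₀, δ ≤ ρ →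
      hexSAWLaw D.carrier δ (a δ) (b δ) {γ | (sawCurve γ).HasTraversals k x ρ R} ≤ ENNReal.ofReal η

/-- generic: per-shell tightness ⇒ the `(k, K, lam, δ₀)` shape with `K = 1`, `lam = 3`. -/
theorem shellBound_of_perShellTight {D : DobrushinDomain} {a b : ℝ → HexVertex}
    {good : ℂ → ℝ → Prop} (h : PerShellTight D a b good) :
    ∃ (k : ℂ → ℝ → ℝ → ℕ) (K lam δ₀ : ℝ), 0 ≤ K ∧ 2 < lam ∧ 0 < δ₀ ∧
      ∀ δ ∈ Set.Ioc 0 δ₀, ∀ (x : ℂ) (ρ R : ℝ), δ ≤ ρ → ρ < R → R ≤ 1 → good x R →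
        hexSAWLaw D.carrier δ (a δ) (b δ)
          {γ | (sawCurve γ).HasTraversals (k x ρ R) x ρ R} ≤ ENNReal.ofReal (K * (ρ / R) ^ lam) := by
  classical
  obtain ⟨δ₀, hδ₀, h⟩ := h
  have key : ∀ (x : ℂ) (ρ R : ℝ), ∃ k : ℕ, 0 < ρ → ρ < R → R ≤ 1 → good x R →
      ∀ δ ∈ Set.Ioc 0 δ₀, δ ≤ ρ →
        hexSAWLaw D.carrier δ (a δ) (b δ) {γ | (sawCurve γ).HasTraversals k x ρ R} ≤
          ENNReal.ofReal ((ρ / R) ^ (3 : ℝ)) := by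
    intro x ρ R
    by_cases hc : 0 < ρ ∧ ρ < R ∧ R ≤ 1 ∧ good x R
    · have hpos : 0 < (ρ / R) ^ (3 : ℝ) :=
        Real.rpow_pos_of_pos (div_pos hc.1 (hc.1.trans hc.2.1)) 3
      obtain ⟨k, hk⟩ := h x ρ R hc.1 hc.2.1 hc.2.2.1 hc.2.2.2 _ hpos
      exact ⟨k, fun _ _ _ _ => hk⟩
    · exact ⟨0, fun h1 h2 h3 h4 => (hc ⟨h1, h2, h3, h4⟩).elim⟩
  choose k hk using key
  refine ⟨k, 1, 3, δ₀, zero_le_one, by norm_num, hδ₀, ?_⟩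
  intro δ hδ x ρ R hδρ hρR hR1 hg
  have hρ : 0 < ρ := hδ.1.trans_le hδρ
  simpa only [one_mul] using hk x ρ R hρ hρR hR1 hg δ hδ hδρ

/-- Per-shell tightness on interior shells ⇒ `InteriorShellBound` (the consumer's shape is rate-free). -/
theorem interiorShellBound_of_perShellTight {D : DobrushinDomain} {a b : ℝ → HexVertex}
    (h : PerShellTight D a b fun x R => closedBall x R ⊆ D.carrier) : InteriorShellBound D a b :=
  shellBound_of_perShellTight h

/-- Per-shell tightness on boundary shells ⇒ `BoundaryShellBound`. -/
theorem boundaryShellBound_of_perShellTight {D : DobrushinDomain} {a b : ℝ → HexVertex}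
    (h : PerShellTight D a b fun x R => ¬ closedBall x R ⊆ D.carrier) : BoundaryShellBound D a b :=
  shellBound_of_perShellTight h

/-- Per-shell tightness on all shells ⇒ the AB rung `HexTraversalBound`. -/
theorem hexTraversalBound_of_perShellTight {D : DobrushinDomain} {a b : ℝ → HexVertex}
    (h : PerShellTight D a b fun _ _ => True) : HexTraversalBound D a b := by
  obtain ⟨k, K, lam, δ₀, hK, hlam, hδ₀, hb⟩ := shellBound_of_perShellTight h
  exact ⟨k, K, lam, δ₀, hK, hlam, hδ₀, fun δ hδ x ρ R h1 h2 h3 => hb δ hδ x ρ R h1 h2 h3 trivial⟩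

/-! ### Compact sets of curve classes have bounded traversal counts -/

/-- Reparametrisation invariance of `HasTraversals`. -/
theorem hasTraversals_reparam_iff (γ : Curve ℂ) (φ : unitInterval ≃o unitInterval) (k : ℕ)
    (x : ℂ) (r R : ℝ) : (γ.reparam φ).HasTraversals k x r R ↔ γ.HasTraversals k x r R := by
  constructor
  · rintro ⟨s, t, hst, hsep⟩
    refine ⟨fun i => φ (s i), fun i => φ (t i), fun i => ?_, fun i j hij => φ.strictMono (hsep hij)⟩
    obtain ⟨hle, h⟩ := hst i
    exact ⟨φ.monotone hle, by simpa [Curve.reparam_apply] using h⟩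
  · rintro ⟨s, t, hst, hsep⟩
    refine ⟨fun i => φ.symm (s i), fun i => φ.symm (t i), fun i => ?_,
      fun i j hij => φ.symm.strictMono (hsep hij)⟩
    obtain ⟨hle, h⟩ := hst i
    exact ⟨φ.symm.monotone hle, by simpa [Curve.reparam_apply] using h⟩

/-- Traversals pass to nearby curves (in the reparametrisation distance) with an `ε` of room. -/
theorem hasTraversals_of_dist_lt {γ₁ γ₂ : Curve ℂ} {ε : ℝ} (hd : dist γ₁ γ₂ < ε) {k : ℕ} {x : ℂ}
    {r R : ℝ} (h : γ₁.HasTraversals k x r R) : γ₂.HasTraversals k x (r + ε) (R - ε) := by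
  rw [Curve.dist_def, Curve.reparamDist] at hd
  obtain ⟨φ, hφ⟩ := exists_lt_of_ciInf_lt hd
  rw [← hasTraversals_reparam_iff γ₂ φ]
  have hpt : ∀ t, dist (γ₁ t) (γ₂.reparam φ t) < ε := fun t =>
    (ContinuousMap.dist_apply_le_dist (f := γ₁.toContinuousMap)
      (g := (γ₂.reparam φ).toContinuousMap) t).trans_lt hφ
  obtain ⟨s, t, hst, hsep⟩ := h
  refine ⟨s, t, fun i => ?_, hsep⟩
  obtain ⟨hle, h⟩ := hst i
  refine ⟨hle, ?_⟩
  have h1 : ∀ u, dist (γ₁ u) x ≤ r → dist (γ₂.reparam φ u) x ≤ r + ε := fun u hu => by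
    linarith [dist_triangle (γ₂.reparam φ u) (γ₁ u) x, dist_comm (γ₁ u) (γ₂.reparam φ u), hpt u]
  have h2 : ∀ u, R ≤ dist (γ₁ u) x → R - ε ≤ dist (γ₂.reparam φ u) x := fun u hu => by
    linarith [dist_triangle (γ₁ u) (γ₂.reparam φ u) x, hpt u]
  rcases h with ⟨ha, hb⟩ | ⟨ha, hb⟩
  · exact Or.inl ⟨h1 _ ha, h2 _ hb⟩
  · exact Or.inr ⟨h2 _ ha, h1 _ hb⟩

/-- **A compact set of curve classes traverses a genuine shell boundedly often.** -/
theorem exists_not_hasTraversals_of_isCompact {𝒦 : Set (CurveClass ℂ)} (h𝒦 : IsCompact 𝒦)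
    (x : ℂ) {r R : ℝ} (hrR : r < R) :
    ∃ k : ℕ, ∀ γ : Curve ℂ, CurveClass.mk γ ∈ 𝒦 → ¬ γ.HasTraversals k x r R := by
  classical
  set ε : ℝ := (R - r) / 3 with hε
  have hε0 : 0 < ε := by rw [hε]; linarith
  -- finite subcover by `ε`-balls centred in `𝒦`
  obtain ⟨T, hT𝒦, hTfin, hcov⟩ := h𝒦.elim_finite_subcover_image (b := 𝒦) (c := fun c => Metric.ball c ε)
    (fun _ _ => Metric.isOpen_ball) (fun c hc => Set.mem_biUnion hc (Metric.mem_ball_self hε0))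
  -- a representative and a threshold for each centre
  have hrep : ∀ c : CurveClass ℂ, ∃ γ : Curve ℂ, CurveClass.mk γ = c := fun c => by
    obtain ⟨γ, hγ⟩ := SeparationQuotient.surjective_mk c
    exact ⟨γ, by rw [CurveClass.mk_eq_separationQuotientMk]; exact hγ⟩
  choose rep hrep using hrep
  have hthr : ∀ c : CurveClass ℂ, ∃ k, ¬ (rep c).HasTraversals k x (r + ε) (R - ε) := fun c =>
    Curve.exists_not_hasTraversals _ _ (by rw [hε]; linarith)
  choose kc hkc using hthr
  refine ⟨hTfin.toFinset.sup kc + 1, fun γ hγ htr => ?_⟩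
  obtain ⟨c, hcT, hγc⟩ := Set.mem_iUnion₂.1 (hcov hγ)
  have hdist : dist γ (rep c) < ε := by
    have := Metric.mem_ball.1 hγc
    rwa [← hrep c, CurveClass.dist_mk_mk] at this
  have hle : kc c ≤ hTfin.toFinset.sup kc + 1 :=
    (Finset.le_sup (f := kc) (hTfin.mem_toFinset.2 hcT)).trans (Nat.le_succ _)
  exact hkc c (hasTraversals_of_dist_lt hdist (htr.of_le hle))

/-- **The AB rung is an equivalence**: `HexTight` ⇒ (H1) for every Dobrushin domain and endpoint
approximation (per-shell thresholds: tightness ⇒ compact set ⇒ bounded traversal count). -/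
theorem hexTraversalBound_of_crux (h : Crux) (D : DobrushinDomain) (a b : ℝ → HexVertex)
    (hab : IsEmbEndpointApprox hexGraph hexCenter D a b) : HexTraversalBound D a b := by
  obtain ⟨δ₀, hδ₀, hT⟩ := hexEventualTight_iff_crux.2 h D a b hab
  refine hexTraversalBound_of_perShellTight ⟨δ₀, hδ₀, fun x ρ R hρ hρR _ _ η hη => ?_⟩
  obtain ⟨𝒦, h𝒦, hμ⟩ := isTightMeasureSet_iff_exists_isCompact_measure_compl_le.1 hT
    (ENNReal.ofReal η) (ENNReal.ofReal_pos.2 hη)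
  obtain ⟨k, hk⟩ := exists_not_hasTraversals_of_isCompact h𝒦 x hρR
  refine ⟨k, fun δ hδ _ => ?_⟩
  have hmem : (hexSAWLaw D.carrier δ (a δ) (b δ)).map (fun γ => γ.curve) ∈
      (fun δ : ℝ => (hexSAWLaw D.carrier δ (a δ) (b δ)).map (fun γ => γ.curve)) '' Set.Ioc 0 δ₀ :=
    ⟨δ, hδ, rfl⟩
  calc hexSAWLaw D.carrier δ (a δ) (b δ) {γ | (sawCurve γ).HasTraversals k x ρ R}
      ≤ hexSAWLaw D.carrier δ (a δ) (b δ) ((fun γ => γ.curve) ⁻¹' 𝒦ᶜ) := by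
        refine measure_mono fun γ hγ h𝒦γ => hk (sawCurve γ) ?_ hγ
        rw [Disproof.mk_sawCurve]; exact h𝒦γ
    _ ≤ (hexSAWLaw D.carrier δ (a δ) (b δ)).map (fun γ => γ.curve) 𝒦ᶜ :=
        Measure.le_map_apply (aemeasurable_embCurve _ _ _ _ _ _ _) _
    _ ≤ ENNReal.ofReal η := hμ _ hmem

/-- Hence `BoundaryShells` and the conclusion of `Virginization` are CONSEQUENCES of the crux. -/
theorem boundaryShells_of_crux (h : Crux) : BoundaryShells := fun D a b hab => by
  obtain ⟨k, K, lam, δ₀, hK, hlam, hδ₀, hb⟩ := hexTraversalBound_of_crux h D a b hab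
  exact ⟨k, K, lam, δ₀, hK, hlam, hδ₀, fun δ hδ x ρ R h1 h2 h3 _ => hb δ hδ x ρ R h1 h2 h3⟩

theorem interiorShellBound_of_crux (h : Crux) (D : DobrushinDomain) (a b : ℝ → HexVertex)
    (hab : IsEmbEndpointApprox hexGraph hexCenter D a b) : InteriorShellBound D a b := by
  obtain ⟨k, K, lam, δ₀, hK, hlam, hδ₀, hb⟩ := hexTraversalBound_of_crux h D a b hab
  exact ⟨k, K, lam, δ₀, hK, hlam, hδ₀, fun δ hδ x ρ R h1 h2 h3 _ => hb δ hδ x ρ R h1 h2 h3⟩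

/-- so `Virginization` holds outright if the crux does (its conclusion is a piece of the crux). -/
theorem virginization_of_crux (h : Crux) : Virginization := fun _ _ D a b hab =>
  interiorShellBound_of_crux h D a b hab

/-! ### Corrected (rate-free, sufficient) signatures for the two arc atoms -/

/-- Rate-free chordal atom: at each aspect ratio `A ≥ 4` the traversal count is TIGHT, uniformly
over virgin configurations. -/
def ArcTraversalTight : Prop :=
  ∀ A : ℝ, 4 ≤ A → ∀ η : ℝ, 0 < η → ∃ (k₀ : ℕ) (N₀ : ℝ), 0 < N₀ ∧
    ∀ (H : SimpleGraph HexVertex) (Λ : Finset HexVertex) (z₀ : ℂ) (N : ℝ)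
      (w w' : Sym2 HexVertex), N₀ ≤ N →
      IsVirgin H Λ z₀ N → Straddles Λ z₀ N w → Straddles Λ z₀ N w' →
      travMass H Λ w w' k₀ z₀ (N / A) (N / 2) ≤ η * arcMass H Λ w w'

/-- Rate-free rooted atom, with the root step a genuine lattice edge (`hexGraph.Adj q p`). -/
def RootedTraversalTight : Prop :=
  ∀ A : ℝ, 4 ≤ A → ∀ η : ℝ, 0 < η → ∃ (k₀ : ℕ) (N₀ : ℝ), 0 < N₀ ∧
    ∀ (H : SimpleGraph HexVertex) (Λ : Finset HexVertex) (z₀ : ℂ) (N : ℝ)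
      (w : Sym2 HexVertex) (p q : HexVertex), N₀ ≤ N →
      IsVirgin H Λ z₀ N → Straddles Λ z₀ N w → dist (hexCenter p) z₀ ≤ N / A →
      hexGraph.Adj q p → H.Adj q p →
      travMass H (Λ.erase p) w s(q, p) k₀ z₀ (N / A) (N / 2) ≤
        η * arcMass H (Λ.erase p) w s(q, p)

/-- junk exposure of `RootedShellBound`: the complete graph is a virgin `H`, and then the
hypothesis `H.Adj q p` only says `q ≠ p`. -/
example (Λ : Finset HexVertex) (z₀ : ℂ) (N : ℝ)
    (h : ∀ v : HexVertex, dist (hexCenter v) z₀ < N → v ∈ Λ) :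
    IsVirgin ⊤ Λ z₀ N := ⟨h, fun _ _ _ _ h => h.ne⟩

example (q p : HexVertex) : (⊤ : SimpleGraph HexVertex).Adj q p ↔ q ≠ p := SimpleGraph.top_adj q p

end PerShell

end Summit.CriticalPhenomena.SAWScalingLimit.Cruxes.HexTight.DrefuteRVD

end

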